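import Literature.Topology.FourManifolds.HomotopySpheresStablyParallelizableStability
import Literature.AlgebraicTopology.Homotopy.HomotopyGroupsGeneralPosition
import Mathlib.Analysis.InnerProductSpace.PiL2
import Mathlib.LinearAlgebra.Matrix.SchurComplement
import Mathlib.LinearAlgebra.Complex.FiniteDimensional
import Mathlib.Analysis.Complex.Basic
import HarnessLib

/-!
# Stability for `πᵢ(GL_n(ℂ))`: `GL_n(ℂ) → GL_{n+1}(ℂ)` is injective on `πᵢ` for `i < 2n`

Topic `Literature/Topology/FourManifolds`, sibling of `…Stability.lean` (the same argument for
`SO(D) → SO(D + 1)` acting on `𝕊ᴰ`), towards the named fact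
`Literature.Topology.FourManifolds.Bott1959_sphereMapsToStableFramesExtend_six` (`π₆(SO(8), 1) = 0`,
Bott 1959), which the tree has reduced to `π₆(SU(4), 1) = 0` (`…SpinSixCover.lean`). Complex
Bott periodicity delivers `π₆` of the *stable* group `GL(ℂ) = ⋃ GL_n(ℂ)`; to come down to
`GL₄(ℂ) ⊃ U(4) ⊃ SU(4)` one needs the classical stability of `πᵢ(GL_n(ℂ)) = πᵢ(U(n))` in the range
`i < 2n` (Bott 1959, §1: "`π_k(U_n) = π_k(U)` for `k < 2n`"; Hatcher, *Algebraic Topology*, §4.2,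
Example 4.55: the bundles `U(n - 1) → U(n) → S²ⁿ⁻¹`; Husemoller, *Fibre Bundles*, Ch. 8 §12).
This file proves the **injectivity half** for `GL_n(ℂ)` acting on `ℂⁿ ∖ {0}` (everything
PROVED; no named facts), by the method of `…Stability.lean`:

* §1 `GLd n = {A ∈ M_n(ℂ) | det A ∈ ℂˣ}` (a group, continuous multiplication), the punctured space
  `CV0 n = ℂⁿ ∖ {0}`, the action `act`, the stabilisation `appendOne : A ↦ A ⊕ 1` and the
  upper-left block `upperLeft`; the stabiliser of `e_last` has determinant `det ∘ upperLeft`.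
* §2 the **transport matrix** `T(a, b) = 1 + (b - a) a^* / ‖a‖²` (`T(a, b) a = b`, `T(a, a) = 1`,
  `det T(a, b) = ⟨a, b⟩ / ‖a‖²`, invertible as soon as `⟨a, b⟩ ≠ 0`), continuous in `(a, b)`.
* §3 **transport along a homotopy** `G : I × Y → ℂⁿ ∖ {0}`, `Y` compact (a modulus of continuity
  making consecutive points non-orthogonal, dyadic induction), hence **homotopy lifting** for
  `A ↦ A e_last : GL_n(ℂ) → ℂⁿ ∖ {0}`, stationary where the homotopy is.
* §4 `π_k(ℂⁿ ∖ {0}) = 0` for `k + 1 < 2n` (radial retraction onto the unit sphere `𝕊²ⁿ⁻¹` and the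
  tree's `subsingleton_homotopyGroup_sphere`).
* §5 **`ι_* : πᵢ(GL_n(ℂ), 1) → πᵢ(GL_{n+1}(ℂ), 1)` is injective for `i + 2 < 2(n + 1)`**
  (`injective_homotopyGroupMap_appendOne`): a homotopy rel `∂Iⁱ` in `GL_{n+1}` between `ι ∘ k`
  and `ι ∘ k'` projects to a map of the cylinder into `ℂⁿ⁺¹ ∖ {0}` which is `e_last` on the whole
  boundary of the cylinder; contract it (`π_{i+1}(ℂⁿ⁺¹ ∖ 0) = 0`), transport the homotopy into the
  stabiliser and read off its upper-left block. Vanishing forms: `π_i(GL_{n+1}) = 0 ⇒ π_i(GL_n) = 0`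
  for `i < 2n`, iterated (`subsingleton_homotopyGroup_GLd_of_add`), and the per-class form
  `genLoop_homotopic_const_of_appendMany` used with Bott periodicity.

## References

* R. Bott, *The stable homotopy of the classical groups*, Ann. of Math. (2) 70 (1959), 313–337,
  §1 (stable range `π_k(U_n) ≅ π_k(U)`, `k < 2n`; `π_k(U) = 0, ℤ`). doi:10.2307/1970106 [Bott1959]
* A. Hatcher, *Algebraic Topology*, CUP (2002), §4.2, Thm. 4.41, Prop. 4.48, Example 4.55
  (the bundles `U(n-1) → U(n) → S²ⁿ⁻¹`, `GL_n`; stability). [HatcherAT2002]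
* D. Husemoller, *Fibre Bundles*, 3rd ed. (1994), Ch. 8 §12 (homotopy groups of the classical
  groups in the stable range). [HusemollerFibreBundles1994]
-/

noncomputable section

open Matrix Set Metric Literature.AlgebraicTopology.Homotopy
open scoped Topology Topology.Homotopy unitInterval ComplexOrder

namespace Literature.Topology.FourManifolds

namespace GLTransport

/-! ### 1. `GL_n(ℂ)` as invertible matrices, `ℂⁿ ∖ {0}`, the action, `A ⊕ 1`, the upper-left block -/

section Basic

variable {n : ℕ}

/-- `GL_n(ℂ)` as the subspace of `M_n(ℂ)` of matrices with invertible determinant (the model of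
`Literature.LinearAlgebra.Matrix.isPathConnected_isUnit_det` and of the `K`-theory files). [folklore] -/
abbrev GLd (n : ℕ) : Type := {A : Matrix (Fin n) (Fin n) ℂ // IsUnit A.det}

/-- The identity matrix as an element of `GL_n(ℂ)`. [folklore] -/
instance : One (GLd n) := ⟨⟨1, by simp⟩⟩

/-- Multiplication in `GL_n(ℂ)`. [folklore] -/
instance : Mul (GLd n) := ⟨fun A B => ⟨A.1 * B.1, by rw [Matrix.det_mul]; exact A.2.mul B.2⟩⟩

/-- Inversion in `GL_n(ℂ)` (the matrix inverse). [folklore] -/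
instance : Inv (GLd n) := ⟨fun A => ⟨A.1⁻¹, by rw [Matrix.det_nonsing_inv]; exact A.2.ringInverse⟩⟩

/-- Underlying matrix of `1`. [folklore] -/
@[simp] theorem coe_one : ((1 : GLd n) : Matrix (Fin n) (Fin n) ℂ) = 1 := rfl
/-- Underlying matrix of a product. [folklore] -/
@[simp] theorem coe_mul (A B : GLd n) : ((A * B : GLd n) : Matrix (Fin n) (Fin n) ℂ) = A.1 * B.1 := rfl
/-- Underlying matrix of an inverse. [folklore] -/
@[simp] theorem coe_inv (A : GLd n) : ((A⁻¹ : GLd n) : Matrix (Fin n) (Fin n) ℂ) = A.1⁻¹ := rfl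

/-- `GL_n(ℂ)` is a group. [folklore] -/
instance : Group (GLd n) where
  mul_assoc A B C := Subtype.ext (Matrix.mul_assoc _ _ _)
  one_mul A := Subtype.ext (Matrix.one_mul _)
  mul_one A := Subtype.ext (Matrix.mul_one _)
  inv_mul_cancel A := Subtype.ext (Matrix.nonsing_inv_mul _ A.2)

/-- Multiplication in `GL_n(ℂ)` is continuous. [folklore] -/
instance : ContinuousMul (GLd n) :=
  ⟨(continuous_subtype_val.fst'.mul continuous_subtype_val.snd').subtype_mk _⟩

/-- The punctured space `ℂⁿ ∖ {0}`. [folklore] -/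
abbrev CV0 (n : ℕ) : Type := {v : Fin n → ℂ // v ≠ 0}

/-- An invertible matrix sends non-zero vectors to non-zero vectors. [folklore] -/
theorem mulVec_ne_zero (A : GLd n) {v : Fin n → ℂ} (hv : v ≠ 0) : A.1 *ᵥ v ≠ 0 := by
  intro h
  apply hv
  have := congrArg (fun w => A.1⁻¹ *ᵥ w) h
  simpa [Matrix.mulVec_mulVec, Matrix.nonsing_inv_mul _ A.2] using this

/-- **The action of `GL_n(ℂ)` on `ℂⁿ ∖ {0}`.** [folklore] -/
def act (A : GLd n) (v : CV0 n) : CV0 n := ⟨A.1 *ᵥ v.1, mulVec_ne_zero A v.2⟩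

/-- Underlying vector of `act A v`. [folklore] -/
@[simp] theorem coe_act (A : GLd n) (v : CV0 n) : (act A v).1 = A.1 *ᵥ v.1 := rfl

/-- `act 1 = id`. [folklore] -/
@[simp] theorem act_one (v : CV0 n) : act 1 v = v := Subtype.ext (by simp)

/-- `act (A B) = act A ∘ act B`. [folklore] -/
theorem act_mul (A B : GLd n) (v : CV0 n) : act (A * B) v = act A (act B v) :=
  Subtype.ext (by simp [Matrix.mulVec_mulVec])

/-- The action is jointly continuous. [folklore] -/
theorem continuous_act : Continuous fun p : GLd n × CV0 n => act p.1 p.2 :=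
  ((continuous_subtype_val.comp continuous_fst).matrix_mulVec
    (continuous_subtype_val.comp continuous_snd)).subtype_mk _

/-- Continuity of the action along continuous families. [folklore] -/
theorem Continuous.act' {X : Type*} [TopologicalSpace X] {F : X → GLd n} {f : X → CV0 n}
    (hF : Continuous F) (hf : Continuous f) : Continuous fun x => act (F x) (f x) :=
  continuous_act.comp (hF.prodMk hf)

/-- The base point `e_last ∈ ℂⁿ⁺¹ ∖ {0}`. [folklore] -/
def eLast (n : ℕ) : CV0 (n + 1) := ⟨Pi.single (Fin.last n) 1, by
  intro h; have := congrFun h (Fin.last n); simp at this⟩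

/-- `eLast n = Pi.single (last n) 1`. [folklore] -/
@[simp] theorem coe_eLast : (eLast n).1 = Pi.single (Fin.last n) 1 := rfl

/-- **The projection `A ↦ A e_last`** (last column). [folklore] -/
def proj (A : GLd (n + 1)) : CV0 (n + 1) := act A (eLast n)

/-- Coordinates of `proj A`: the last column of `A`. [folklore] -/
theorem coe_proj_apply (A : GLd (n + 1)) (i : Fin (n + 1)) : (proj A).1 i = A.1 i (Fin.last n) := by
  simp [proj]

/-- `proj` is continuous. [folklore] -/
theorem continuous_proj : Continuous (proj : GLd (n + 1) → CV0 (n + 1)) :=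
  Continuous.act' continuous_id continuous_const

/-- `proj (A B) = act A (proj B)`. [folklore] -/
theorem proj_mul (A B : GLd (n + 1)) : proj (A * B) = act A (proj B) := act_mul A B _

/-- `proj 1 = e_last`. [folklore] -/
@[simp] theorem proj_one : proj (1 : GLd (n + 1)) = eLast n := act_one _

/-- **`A ⊕ 1`**: the matrix `A` bordered by a last row and column of the identity. [folklore] -/
def appendOne (A : Matrix (Fin n) (Fin n) ℂ) : Matrix (Fin (n + 1)) (Fin (n + 1)) ℂ :=
  Matrix.of (Fin.snoc (fun i => Fin.snoc (A i) 0) (Fin.snoc 0 1 : Fin (n + 1) → ℂ))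

/-- Entries of `A ⊕ 1`. [folklore] -/
@[simp] theorem appendOne_castSucc_castSucc (A : Matrix (Fin n) (Fin n) ℂ) (i j : Fin n) :
    appendOne A i.castSucc j.castSucc = A i j := by simp [appendOne]
/-- Entries of `A ⊕ 1`. [folklore] -/
@[simp] theorem appendOne_castSucc_last (A : Matrix (Fin n) (Fin n) ℂ) (i : Fin n) :
    appendOne A i.castSucc (Fin.last n) = 0 := by simp [appendOne]
/-- Entries of `A ⊕ 1`. [folklore] -/
@[simp] theorem appendOne_last_castSucc (A : Matrix (Fin n) (Fin n) ℂ) (j : Fin n) :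
    appendOne A (Fin.last n) j.castSucc = 0 := by simp [appendOne]
/-- Entries of `A ⊕ 1`. [folklore] -/
@[simp] theorem appendOne_last_last (A : Matrix (Fin n) (Fin n) ℂ) :
    appendOne A (Fin.last n) (Fin.last n) = 1 := by simp [appendOne]

/-- `1 ⊕ 1 = 1`. [folklore] -/
theorem appendOne_one : appendOne (1 : Matrix (Fin n) (Fin n) ℂ) = 1 := by
  ext i j
  refine Fin.lastCases ?_ (fun i' => ?_) i <;> refine Fin.lastCases ?_ (fun j' => ?_) j
  · simp
  · simp [(Fin.castSucc_lt_last j').ne']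
  · simp [(Fin.castSucc_lt_last i').ne]
  · simp [Matrix.one_apply, Fin.castSucc_inj]

/-- `(A ⊕ 1)(B ⊕ 1) = AB ⊕ 1`. [folklore] -/
theorem appendOne_mul (A B : Matrix (Fin n) (Fin n) ℂ) : appendOne (A * B) = appendOne A * appendOne B := by
  ext i j
  refine Fin.lastCases ?_ (fun i' => ?_) i <;> refine Fin.lastCases ?_ (fun j' => ?_) j <;>
    simp [Matrix.mul_apply, Fin.sum_univ_castSucc]

/-- The **upper-left block** of an `(n + 1) × (n + 1)` matrix. [folklore] -/
def upperLeft (B : Matrix (Fin (n + 1)) (Fin (n + 1)) ℂ) : Matrix (Fin n) (Fin n) ℂ :=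
  B.submatrix Fin.castSucc Fin.castSucc

/-- `upperLeft (A ⊕ 1) = A`. [folklore] -/
@[simp] theorem upperLeft_appendOne (A : Matrix (Fin n) (Fin n) ℂ) : upperLeft (appendOne A) = A := by
  ext i j; simp [upperLeft]

/-- `upperLeft` is continuous. [folklore] -/
theorem continuous_upperLeft : Continuous (upperLeft : Matrix (Fin (n + 1)) (Fin (n + 1)) ℂ → _) :=
  continuous_id.matrix_submatrix _ _

/-- `appendOne` is continuous. [folklore] -/
theorem continuous_appendOne : Continuous (appendOne : Matrix (Fin n) (Fin n) ℂ → _) := by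
  refine continuous_matrix fun i j => ?_
  refine Fin.lastCases ?_ (fun i' => ?_) i <;> refine Fin.lastCases ?_ (fun j' => ?_) j
  · simp only [appendOne_last_last]; exact continuous_const
  · simp only [appendOne_last_castSucc]; exact continuous_const
  · simp only [appendOne_castSucc_last]; exact continuous_const
  · simp only [appendOne_castSucc_castSucc]; exact (continuous_apply j').comp (continuous_apply i')

/-- **A matrix whose last column is `e_last` has determinant equal to that of its upper-left
block** (expansion along the last column). [folklore] -/
theorem det_eq_det_upperLeft {B : Matrix (Fin (n + 1)) (Fin (n + 1)) ℂ}
    (h : ∀ i, B i (Fin.last n) = (Pi.single (Fin.last n) (1 : ℂ) : Fin (n + 1) → ℂ) i) :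
    B.det = (upperLeft B).det := by
  rw [Matrix.det_succ_column B (Fin.last n), Fin.sum_univ_castSucc]
  have h0 : ∀ i : Fin n, B i.castSucc (Fin.last n) = 0 := fun i => by
    rw [h]; simp [(Fin.castSucc_lt_last i).ne]
  have hl : B (Fin.last n) (Fin.last n) = 1 := by rw [h]; simp
  rw [Finset.sum_eq_zero (fun i _ => by rw [h0 i, mul_zero, zero_mul]), zero_add, hl, mul_one,
    Fin.succAbove_last, Fin.val_last, ← two_mul, pow_mul, neg_one_sq, one_pow, one_mul]
  rfl

/-- `det (A ⊕ 1) = det A`. [folklore] -/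
theorem det_appendOne (A : Matrix (Fin n) (Fin n) ℂ) : (appendOne A).det = A.det := by
  rw [det_eq_det_upperLeft, upperLeft_appendOne]
  intro i
  refine Fin.lastCases ?_ (fun i' => ?_) i
  · simp
  · simp [(Fin.castSucc_lt_last i').ne]

/-- **The stabilisation `ι : GL_n(ℂ) → GL_{n+1}(ℂ)`, `A ↦ A ⊕ 1`**, as a continuous map. [folklore] -/
def appendOneGL : C(GLd n, GLd (n + 1)) :=
  ⟨fun A => ⟨appendOne A.1, (det_appendOne A.1).symm ▸ A.2⟩,
    (continuous_appendOne.comp continuous_subtype_val).subtype_mk _⟩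

/-- Underlying matrix of `ι A`. [folklore] -/
@[simp] theorem coe_appendOneGL (A : GLd n) : (appendOneGL A).1 = appendOne A.1 := rfl

/-- `ι 1 = 1`. [folklore] -/
@[simp] theorem appendOneGL_one : appendOneGL (1 : GLd n) = 1 := Subtype.ext appendOne_one

/-- `ι A` fixes `e_last`. [folklore] -/
theorem proj_appendOneGL (A : GLd n) : proj (appendOneGL A) = eLast n := by
  apply Subtype.ext
  funext i
  rw [coe_proj_apply, coe_appendOneGL, coe_eLast]
  refine Fin.lastCases ?_ (fun i' => ?_) i
  · simp
  · simp [(Fin.castSucc_lt_last i').ne]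

/-- **The stabiliser of `e_last`**: if `proj B = e_last` then `det B = det (upperLeft B)`, so the
upper-left block of `B` is invertible. [folklore] -/
theorem isUnit_det_upperLeft {B : GLd (n + 1)} (hB : proj B = eLast n) : IsUnit (upperLeft B.1).det := by
  have h : ∀ i, B.1 i (Fin.last n) = (Pi.single (Fin.last n) (1 : ℂ) : Fin (n + 1) → ℂ) i := fun i => by
    rw [← coe_proj_apply, hB, coe_eLast]
  rw [← det_eq_det_upperLeft h]
  exact B.2

end Basic

/-! ### 2. The transport matrix `T(a, b) = 1 + (b - a) a^* / ‖a‖²` -/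

section TransportMatrix

variable {n : ℕ}

/-- `⟨a, a⟩ = a^* a ≠ 0` for `a ≠ 0`. [folklore] -/
theorem star_dotProduct_self_ne_zero {a : Fin n → ℂ} (ha : a ≠ 0) : star a ⬝ᵥ a ≠ 0 :=
  fun h => ha (dotProduct_star_self_eq_zero.1 h)

/-- **The transport matrix** `T(a, b) = 1 + ⟨a, a⟩⁻¹ (b - a) a^*`. [folklore] -/
def tMat (a b : Fin n → ℂ) : Matrix (Fin n) (Fin n) ℂ :=
  1 + vecMulVec ((star a ⬝ᵥ a)⁻¹ • (b - a)) (star a)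

/-- `T(a, b) a = b` (`a ≠ 0`). [folklore] -/
theorem tMat_mulVec_self {a : Fin n → ℂ} (ha : a ≠ 0) (b : Fin n → ℂ) : tMat a b *ᵥ a = b := by
  rw [tMat, Matrix.add_mulVec, Matrix.one_mulVec, vecMulVec_mulVec, op_smul_eq_smul, smul_smul,
    mul_inv_cancel₀ (star_dotProduct_self_ne_zero ha), one_smul, add_sub_cancel]

/-- `T(a, a) = 1`. [folklore] -/
theorem tMat_self (a : Fin n → ℂ) : tMat a a = 1 := by
  ext i j; simp [tMat]

/-- **`det T(a, b) = 1 + ⟨a, a⟩⁻¹ ⟨a, b - a⟩`** (matrix determinant lemma). [folklore] -/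
theorem det_tMat (a b : Fin n → ℂ) : (tMat a b).det = 1 + (star a ⬝ᵥ a)⁻¹ * (star a ⬝ᵥ (b - a)) := by
  rw [tMat, vecMulVec_eq (Fin 1), Matrix.det_one_add_replicateCol_mul_replicateRow, dotProduct_smul, smul_eq_mul]

/-- `T(a, b)` is invertible as soon as `⟨a, b⟩ ≠ 0` (`a ≠ 0`). [folklore] -/
theorem isUnit_det_tMat {a b : Fin n → ℂ} (ha : a ≠ 0) (hab : star a ⬝ᵥ b ≠ 0) : IsUnit (tMat a b).det := by
  rw [det_tMat, dotProduct_sub, mul_sub, inv_mul_cancel₀ (star_dotProduct_self_ne_zero ha), add_sub_cancel,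
    isUnit_iff_ne_zero]
  exact mul_ne_zero (inv_ne_zero (star_dotProduct_self_ne_zero ha)) hab

/-- `(a, b) ↦ T(a, b)` is continuous on `{a ≠ 0}`. [folklore] -/
theorem continuous_tMat {X : Type*} [TopologicalSpace X] {f g : X → Fin n → ℂ} (hf : Continuous f)
    (hg : Continuous g) (hf0 : ∀ x, f x ≠ 0) : Continuous fun x => tMat (f x) (g x) := by
  have hc : Continuous fun x => (star (f x) ⬝ᵥ f x)⁻¹ :=
    ((continuous_star.comp hf).dotProduct hf).inv₀ fun x => star_dotProduct_self_ne_zero (hf0 x)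
  unfold tMat
  refine continuous_const.add (continuous_matrix fun i j => ?_)
  simp only [vecMulVec_apply, Pi.smul_apply, Pi.sub_apply, Pi.star_apply, smul_eq_mul]
  exact (hc.mul (((continuous_apply i).comp hg).sub ((continuous_apply i).comp hf))).mul
    (continuous_star.comp ((continuous_apply j).comp hf))

end TransportMatrix

/-! ### 3. Transport along a homotopy in `ℂⁿ ∖ {0}`; homotopy lifting for `A ↦ A e_last` -/

section Transport

variable {n : ℕ} {X : Type*} [TopologicalSpace X]

/-- **The transport family**: for continuous `a, b : X → ℂⁿ ∖ {0}` with `⟨a x, b x⟩ ≠ 0`, the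
continuous family `x ↦ T(a x, b x) ∈ GL_n(ℂ)`. [folklore] -/
def trot (a b : C(X, CV0 n)) (h : ∀ x, star (a x).1 ⬝ᵥ (b x).1 ≠ 0) : C(X, GLd n) where
  toFun x := ⟨tMat (a x).1 (b x).1, isUnit_det_tMat (a x).2 (h x)⟩
  continuous_toFun := (continuous_tMat (continuous_subtype_val.comp a.continuous)
    (continuous_subtype_val.comp b.continuous) fun x => (a x).2).subtype_mk _

/-- The transport matrix takes `a x` to `b x`. [folklore] -/
theorem act_trot_apply (a b : C(X, CV0 n)) (h : ∀ x, star (a x).1 ⬝ᵥ (b x).1 ≠ 0) (x : X) :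
    act (trot a b h x) (a x) = b x :=
  Subtype.ext (tMat_mulVec_self (a x).2 _)

/-- The transport matrix is `1` where `a x = b x`. [folklore] -/
theorem trot_apply_of_eq (a b : C(X, CV0 n)) (h : ∀ x, star (a x).1 ⬝ᵥ (b x).1 ≠ 0) {x : X}
    (hx : a x = b x) : trot a b h x = 1 :=
  Subtype.ext (by change tMat (a x).1 (b x).1 = 1; rw [hx, tMat_self])

end Transport

open SOTransport (halfL halfR coe_halfL coe_halfR)

section Lifting

variable {n : ℕ} {Y : Type*} [TopologicalSpace Y]

/-- **One short step**: if along the homotopy `G : I × Y → ℂⁿ ∖ {0}` no point becomes orthogonal to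
its starting position, the transport matrices `Φ(s, y) = T(G(0, y), G(s, y))` form a continuous
`GL_n(ℂ)`-valued family with `Φ(0, y) = 1`, `Φ(s, y) G(0, y) = G(s, y)`, and `Φ(·, y) ≡ 1` wherever
`G(·, y)` is constant. [folklore] -/
theorem exists_transport_of_ne (G : C(I × Y, CV0 n)) (hG : ∀ s y, star (G (0, y)).1 ⬝ᵥ (G (s, y)).1 ≠ 0) :
    ∃ Φ : C(I × Y, GLd n), (∀ y, Φ (0, y) = 1) ∧ (∀ s y, act (Φ (s, y)) (G (0, y)) = G (s, y)) ∧
      (∀ y, (∀ s, G (s, y) = G (0, y)) → ∀ s, Φ (s, y) = 1) := by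
  let a : C(I × Y, CV0 n) := ⟨fun z => G (0, z.2), G.continuous.comp (continuous_const.prodMk continuous_snd)⟩
  have hab : ∀ z : I × Y, star (a z).1 ⬝ᵥ (G z).1 ≠ 0 := fun z => hG z.1 z.2
  refine ⟨trot a G hab, fun y => ?_, fun s y => ?_, fun y hy s => ?_⟩
  · exact trot_apply_of_eq a G hab rfl
  · exact act_trot_apply a G hab (s, y)
  · exact trot_apply_of_eq a G hab (hy s).symm

/-- **Dyadic induction**: a transport family exists for every homotopy with a modulus `2⁻ʲ` in the
time variable (points at times `≤ 2⁻ʲ` apart are never orthogonal). [folklore] -/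
theorem exists_transport_of_modulus (j : ℕ) :
    ∀ G : C(I × Y, CV0 n),
      (∀ s s' : I, |(s : ℝ) - s'| ≤ (1 / 2 : ℝ) ^ j → ∀ y, star (G (s, y)).1 ⬝ᵥ (G (s', y)).1 ≠ 0) →
      ∃ Φ : C(I × Y, GLd n), (∀ y, Φ (0, y) = 1) ∧ (∀ s y, act (Φ (s, y)) (G (0, y)) = G (s, y)) ∧
        (∀ y, (∀ s, G (s, y) = G (0, y)) → ∀ s, Φ (s, y) = 1) := by
  induction j with
  | zero =>
    intro G hG
    refine exists_transport_of_ne G fun s y => hG 0 s ?_ y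
    have h0 : ((0 : I) : ℝ) = 0 := rfl
    rw [pow_zero, abs_sub_le_iff, h0]
    constructor <;> linarith [s.2.1, s.2.2]
  | succ j ih =>
    intro G hG
    let G₁ : C(I × Y, CV0 n) := G.comp (halfL.prodMap (ContinuousMap.id Y))
    let G₂ : C(I × Y, CV0 n) := G.comp (halfR.prodMap (ContinuousMap.id Y))
    have hG₁ : ∀ s y, G₁ (s, y) = G (halfL s, y) := fun s y => rfl
    have hG₂ : ∀ s y, G₂ (s, y) = G (halfR s, y) := fun s y => rfl
    have hG₁' : ∀ (t s : I) (y : Y), (t : ℝ) = 2 * s → G₁ (t, y) = G (s, y) := by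
      intro t s y hts
      rw [hG₁]
      congr 2
      exact Subtype.ext (by rw [coe_halfL, hts]; ring)
    have hG₂' : ∀ (t s : I) (y : Y), (t : ℝ) = 2 * s - 1 → G₂ (t, y) = G (s, y) := by
      intro t s y hts
      rw [hG₂]
      congr 2
      exact Subtype.ext (by rw [coe_halfR, hts]; ring)
    have hLR : halfL 1 = halfR 0 := Subtype.ext (by norm_num [coe_halfL, coe_halfR])
    have hpow : (1 / 2 : ℝ) ^ (j + 1) = (1 / 2) ^ j / 2 := by rw [pow_succ]; ring
    obtain ⟨Φ₁, h₁0, h₁r, h₁s⟩ := ih G₁ fun s s' hss' y => by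
      rw [hG₁, hG₁]
      refine hG _ _ ?_ y
      rw [coe_halfL, coe_halfL, hpow, ← sub_div, abs_div, abs_two]
      exact div_le_div_of_nonneg_right hss' zero_le_two
    obtain ⟨Φ₂, h₂0, h₂r, h₂s⟩ := ih G₂ fun s s' hss' y => by
      rw [hG₂, hG₂]
      refine hG _ _ ?_ y
      rw [coe_halfR, coe_halfR, hpow, ← sub_div, abs_div, abs_two, add_sub_add_left_eq_sub]
      exact div_le_div_of_nonneg_right hss' zero_le_two
    let f₁ : C(Y, GLd n) := ⟨fun y => Φ₁ (1, y), Φ₁.continuous.comp (continuous_const.prodMk continuous_id)⟩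
    let f₂ : C(Y, GLd n) := ⟨fun y => Φ₂ (1, y) * Φ₁ (1, y),
      (Φ₂.continuous.comp (continuous_const.prodMk continuous_id)).mul
        (Φ₁.continuous.comp (continuous_const.prodMk continuous_id))⟩
    let F₁ : (ContinuousMap.const Y (1 : GLd n)).Homotopy f₁ :=
      { toContinuousMap := Φ₁
        map_zero_left := fun y => h₁0 y
        map_one_left := fun y => rfl }
    let F₂ : f₁.Homotopy f₂ :=
      { toFun := fun z => Φ₂ z * Φ₁ (1, z.2)
        continuous_toFun := Φ₂.continuous.mul (Φ₁.continuous.comp (continuous_const.prodMk continuous_snd))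
        map_zero_left := fun y => by
          show Φ₂ (0, y) * Φ₁ (1, y) = Φ₁ (1, y)
          rw [h₂0, one_mul]
        map_one_left := fun y => rfl }
    refine ⟨(F₁.trans F₂).toContinuousMap, fun y => ?_, fun s y => ?_, fun y hy s => ?_⟩
    · exact (F₁.trans F₂).apply_zero y
    · change act ((F₁.trans F₂) (s, y)) (G (0, y)) = G (s, y)
      rw [ContinuousMap.Homotopy.trans_apply]
      split_ifs with h
      · change act (Φ₁ (⟨2 * (s : ℝ), _⟩, y)) (G (0, y)) = G (s, y)
        have e0 : G (0, y) = G₁ (0, y) := (hG₁' 0 0 y (by simp)).symm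
        rw [e0, h₁r]
        exact hG₁' _ s y rfl
      · change act (Φ₂ (⟨2 * (s : ℝ) - 1, _⟩, y) * Φ₁ (1, y)) (G (0, y)) = G (s, y)
        have e0 : G (0, y) = G₁ (0, y) := (hG₁' 0 0 y (by simp)).symm
        have e1 : G₁ (1, y) = G₂ (0, y) := by rw [hG₁, hG₂, hLR]
        rw [act_mul, e0, h₁r, e1, h₂r]
        exact hG₂' _ s y rfl
    · have hy₁ : ∀ s, G₁ (s, y) = G₁ (0, y) := fun s => by rw [hG₁, hG₁, hy, hy (halfL 0)]
      have hy₂ : ∀ s, G₂ (s, y) = G₂ (0, y) := fun s => by rw [hG₂, hG₂, hy, hy (halfR 0)]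
      change (F₁.trans F₂) (s, y) = 1
      rw [ContinuousMap.Homotopy.trans_apply]
      split_ifs with h
      · exact h₁s y hy₁ _
      · change Φ₂ (⟨2 * (s : ℝ) - 1, _⟩, y) * Φ₁ (1, y) = 1
        rw [h₂s y hy₂, h₁s y hy₁, one_mul]

/-- **A modulus in the time variable** for a homotopy `G : I × Y → ℂⁿ ∖ {0}` with `Y` compact: for
some `j`, points at times `≤ 2⁻ʲ` apart are never orthogonal (the set of orthogonal triples
`(s, s', y)` is compact and `|s - s'| > 0` on it, since `⟨v, v⟩ ≠ 0`). [folklore] -/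
theorem exists_modulus [CompactSpace Y] (G : C(I × Y, CV0 n)) :
    ∃ j : ℕ, ∀ s s' : I, |(s : ℝ) - s'| ≤ (1 / 2 : ℝ) ^ j → ∀ y, star (G (s, y)).1 ⬝ᵥ (G (s', y)).1 ≠ 0 := by
  let K : Set (I × I × Y) := {p | star (G (p.1, p.2.2)).1 ⬝ᵥ (G (p.2.1, p.2.2)).1 = 0}
  have hd : Continuous fun p : I × I × Y => star (G (p.1, p.2.2)).1 ⬝ᵥ (G (p.2.1, p.2.2)).1 :=
    (continuous_star.comp (continuous_subtype_val.comp (G.continuous.comp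
      (continuous_fst.prodMk (continuous_snd.comp continuous_snd))))).dotProduct
      (continuous_subtype_val.comp (G.continuous.comp ((continuous_fst.comp continuous_snd).prodMk
        (continuous_snd.comp continuous_snd))))
  have hK : IsCompact K := (isClosed_eq hd continuous_const).isCompact
  let f : I × I × Y → ℝ := fun p => |(p.1 : ℝ) - p.2.1|
  have hf : Continuous f := ((continuous_subtype_val.comp continuous_fst).sub
    (continuous_subtype_val.comp (continuous_fst.comp continuous_snd))).abs
  rcases K.eq_empty_or_nonempty with hKe | hKne
  · refine ⟨0, fun s s' _ y h => ?_⟩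
    have : (s, s', y) ∈ K := h
    rw [hKe] at this
    exact this
  · obtain ⟨p₀, hp₀K, hp₀⟩ := hK.exists_isMinOn hKne hf.continuousOn
    have hδ : 0 < f p₀ := by
      refine lt_of_le_of_ne (abs_nonneg _) fun h0 => ?_
      have hs : p₀.1 = p₀.2.1 := Subtype.ext (by
        have := abs_eq_zero.mp h0.symm
        linarith)
      have h2 : star (G (p₀.1, p₀.2.2)).1 ⬝ᵥ (G (p₀.2.1, p₀.2.2)).1 = 0 := hp₀K
      rw [hs] at h2
      exact star_dotProduct_self_ne_zero (G (p₀.2.1, p₀.2.2)).2 h2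
    obtain ⟨j, hj⟩ := exists_pow_lt_of_lt_one hδ (by norm_num : (1 / 2 : ℝ) < 1)
    refine ⟨j, fun s s' hss' y h => ?_⟩
    have hmem : (s, s', y) ∈ K := h
    have := hp₀ hmem
    rw [mem_setOf_eq] at this
    exact absurd (lt_of_le_of_lt hss' hj) (not_lt.mpr this)

/-- **Transport along a homotopy** in `ℂⁿ ∖ {0}` with compact parameter space. [folklore] -/
theorem exists_transport [CompactSpace Y] (G : C(I × Y, CV0 n)) :
    ∃ Φ : C(I × Y, GLd n), (∀ y, Φ (0, y) = 1) ∧ (∀ s y, act (Φ (s, y)) (G (0, y)) = G (s, y)) ∧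
      (∀ y, (∀ s, G (s, y) = G (0, y)) → ∀ s, Φ (s, y) = 1) := by
  obtain ⟨j, hj⟩ := exists_modulus G
  exact exists_transport_of_modulus j G hj

/-- **Homotopy lifting for `A ↦ A e_last : GL_{n+1}(ℂ) → ℂⁿ⁺¹ ∖ {0}`** (Hatcher, Prop. 4.48 for
this bundle, Example 4.55: `GL_n(ℂ) → GL_{n+1}(ℂ) → ℂⁿ⁺¹ ∖ 0`), stationary where the homotopy is.
[cite: HatcherAT2002, Prop. 4.48 with Example 4.55] -/
theorem exists_lift [CompactSpace Y] (G : C(I × Y, CV0 (n + 1))) (f : C(Y, GLd (n + 1)))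
    (hf : ∀ y, proj (f y) = G (0, y)) :
    ∃ F : C(I × Y, GLd (n + 1)), (∀ y, F (0, y) = f y) ∧ (∀ s y, proj (F (s, y)) = G (s, y)) ∧
      (∀ y, (∀ s, G (s, y) = G (0, y)) → ∀ s, F (s, y) = f y) := by
  obtain ⟨Φ, h0, hr, hs⟩ := exists_transport G
  refine ⟨⟨fun z => Φ z * f z.2, Φ.continuous.mul (f.continuous.comp continuous_snd)⟩,
    fun y => ?_, fun s y => ?_, fun y hy s => ?_⟩
  · change Φ (0, y) * f y = f y
    rw [h0, one_mul]
  · change proj (Φ (s, y) * f y) = G (s, y)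
    rw [proj_mul, hf, hr]
  · change Φ (s, y) * f y = f y
    rw [hs y hy, one_mul]

end Lifting

/-! ### 4. `π_k(ℂⁿ ∖ {0}) = 0` for `k + 1 < 2n` -/

section Punctured

variable {n : ℕ}

/-- The normalisation `ℂⁿ ∖ {0} → 𝕊²ⁿ⁻¹` (unit sphere of `ℂⁿ` with its real structure). [folklore] -/
def normalize : C(CV0 n, sphere (0 : EuclideanSpace ℂ (Fin n)) 1) where
  toFun v := ⟨(‖WithLp.toLp 2 v.1‖⁻¹ : ℝ) • WithLp.toLp 2 v.1, by
    have hv : WithLp.toLp 2 v.1 ≠ (0 : EuclideanSpace ℂ (Fin n)) := fun h =>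
      v.2 ((WithLp.toLp_injective 2).eq_iff.1 (by rw [h]; rfl))
    rw [mem_sphere_zero_iff_norm, norm_smul, norm_inv, norm_norm, inv_mul_cancel₀ (norm_ne_zero_iff.2 hv)]⟩
  continuous_toFun := by
    refine Continuous.subtype_mk ?_ _
    have hc : Continuous fun v : CV0 n => (WithLp.toLp 2 v.1 : EuclideanSpace ℂ (Fin n)) :=
      (PiLp.continuous_toLp 2 _).comp continuous_subtype_val
    refine (Continuous.inv₀ hc.norm fun v => ?_).smul hc
    exact norm_ne_zero_iff.2 fun h => v.2 ((WithLp.toLp_injective 2).eq_iff.1 (by rw [h]; rfl))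

/-- The inclusion `𝕊²ⁿ⁻¹ → ℂⁿ ∖ {0}`. [folklore] -/
def sphereIncl : C(sphere (0 : EuclideanSpace ℂ (Fin n)) 1, CV0 n) where
  toFun u := ⟨WithLp.ofLp (u : EuclideanSpace ℂ (Fin n)), fun h => by
    have : (u : EuclideanSpace ℂ (Fin n)) = 0 := (WithLp.ofLp_injective 2) (by rw [h]; rfl)
    exact ne_zero_of_mem_unit_sphere u this⟩
  continuous_toFun := ((PiLp.continuous_ofLp 2 _).comp continuous_subtype_val).subtype_mk _

/-- The coefficient `(1 - t)/‖v‖ + t` of the radial homotopy is positive. [folklore] -/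
theorem radialCoeff_pos (p : I × CV0 n) : 0 < (1 - (p.1 : ℝ)) * ‖(WithLp.toLp 2 p.2.1 : EuclideanSpace ℂ (Fin n))‖⁻¹ + (p.1 : ℝ) := by
  have hv : WithLp.toLp 2 p.2.1 ≠ (0 : EuclideanSpace ℂ (Fin n)) := fun h =>
    p.2.2 ((WithLp.toLp_injective 2).eq_iff.1 (by rw [h]; rfl))
  rcases eq_or_lt_of_le p.1.2.2 with h1 | h1
  · rw [h1]; norm_num
  · have : 0 < (1 - (p.1 : ℝ)) * ‖(WithLp.toLp 2 p.2.1 : EuclideanSpace ℂ (Fin n))‖⁻¹ :=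
      mul_pos (by linarith) (inv_pos.2 (norm_pos_iff.2 hv))
    linarith [p.1.2.1]

/-- The radial homotopy `(t, v) ↦ ((1 - t)/‖v‖ + t) v` in `ℂⁿ ∖ {0}`. [folklore] -/
def radialHomotopy : C(I × CV0 n, CV0 n) where
  toFun p := ⟨(((1 - (p.1 : ℝ)) * ‖(WithLp.toLp 2 p.2.1 : EuclideanSpace ℂ (Fin n))‖⁻¹ + (p.1 : ℝ) : ℝ) : ℂ) • p.2.1, by
    intro h
    rw [smul_eq_zero] at h
    rcases h with h | h
    · exact (radialCoeff_pos p).ne' (by exact_mod_cast h)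
    · exact p.2.2 h⟩
  continuous_toFun := by
    refine continuous_induced_rng.2 ?_
    change Continuous fun p : I × CV0 n =>
      (((1 - (p.1 : ℝ)) * ‖(WithLp.toLp 2 p.2.1 : EuclideanSpace ℂ (Fin n))‖⁻¹ + (p.1 : ℝ) : ℝ) : ℂ) • p.2.1
    have hv : Continuous fun p : I × CV0 n => p.2.1 := continuous_subtype_val.comp continuous_snd
    have hc : Continuous fun p : I × CV0 n => (WithLp.toLp 2 p.2.1 : EuclideanSpace ℂ (Fin n)) :=
      (PiLp.continuous_toLp 2 _).comp hv
    have hr : Continuous fun p : I × CV0 n =>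
        (1 - (p.1 : ℝ)) * ‖(WithLp.toLp 2 p.2.1 : EuclideanSpace ℂ (Fin n))‖⁻¹ + (p.1 : ℝ) := by
      refine (((continuous_const.sub (continuous_subtype_val.comp continuous_fst)).mul
        (hc.norm.inv₀ fun p => ?_)).add (continuous_subtype_val.comp continuous_fst))
      exact norm_ne_zero_iff.2 fun h => p.2.2 ((WithLp.toLp_injective 2).eq_iff.1 (by rw [h]; rfl))
    exact (Complex.continuous_ofReal.comp hr).smul hv

/-- Value of the radial homotopy. [folklore] -/
theorem coe_radialHomotopy (p : I × CV0 n) : (radialHomotopy p).1 =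
    (((1 - (p.1 : ℝ)) * ‖(WithLp.toLp 2 p.2.1 : EuclideanSpace ℂ (Fin n))‖⁻¹ + (p.1 : ℝ) : ℝ) : ℂ) • p.2.1 := rfl

/-- `incl ∘ normalize ≃ id` on `ℂⁿ ∖ {0}` (the segment from `v/‖v‖` to `v` misses `0`). [folklore] -/
theorem homotopic_sphereIncl_comp_normalize :
    ((sphereIncl (n := n)).comp normalize).Homotopic (ContinuousMap.id (CV0 n)) := by
  refine ⟨{ toContinuousMap := radialHomotopy
            map_zero_left := fun v => ?_
            map_one_left := fun v => ?_ }⟩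
  · apply Subtype.ext
    change (radialHomotopy (0, v)).1 = WithLp.ofLp ((‖(WithLp.toLp 2 v.1 : EuclideanSpace ℂ (Fin n))‖⁻¹ : ℝ) •
      (WithLp.toLp 2 v.1 : EuclideanSpace ℂ (Fin n)))
    rw [coe_radialHomotopy, WithLp.ofLp_smul, WithLp.ofLp_toLp, ← Complex.coe_smul]
    congr 1
    push_cast
    simp
  · apply Subtype.ext
    change (radialHomotopy (1, v)).1 = v.1
    rw [coe_radialHomotopy]
    simp

/-- **`π_k(ℂⁿ ∖ {0}) = 0` for `k + 1 < 2n`** (`ℂⁿ ∖ {0}` is dominated by — indeed deformation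
retracts onto — the sphere `𝕊²ⁿ⁻¹`, and `π_k(𝕊²ⁿ⁻¹) = 0`, Hatcher Cor. 4.9, the tree's
`subsingleton_homotopyGroup_sphere`). [cite: HatcherAT2002, Cor. 4.9] -/
theorem subsingleton_homotopyGroup_CV0 {k : ℕ} (hk : k + 1 < 2 * n) (v : CV0 n) :
    Subsingleton (HomotopyGroup (Fin k) (CV0 n) v) := by
  have hE : k + 1 < Module.finrank ℝ (EuclideanSpace ℂ (Fin n)) := by
    rw [finrank_real_of_complex, finrank_euclideanSpace_fin]; exact hk
  exact subsingleton_homotopyGroup_of_leftHomotopyInverse normalize sphereIncl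
    homotopic_sphereIncl_comp_normalize v (subsingleton_homotopyGroup_sphere hE _)

end Punctured

/-! ### 5. Injectivity of `ι_* : πᵢ(GL_n(ℂ)) → πᵢ(GL_{n+1}(ℂ))` for `i + 2 < 2(n + 1)` -/

section Stability

open SOTransport (nonempty_homotopyRel_cylBd_of_subsingleton)

variable {n i : ℕ}

/-- **Injectivity half of stability for `GL_n(ℂ)`** (Bott 1959 §1: `π_k(U_n) = π_k(U)` for
`k < 2n`; Hatcher §4.2, Example 4.55): for `i + 2 < 2(n + 1)` the stabilisation
`ι_* : πᵢ(GL_n(ℂ), 1) → πᵢ(GL_{n+1}(ℂ), 1)` is injective. *Proof.* A homotopy `H` rel `∂Iⁱ` in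
`GL_{n+1}` between `ι ∘ k` and `ι ∘ k'` projects (`A ↦ A e_last`) to a map of the cylinder `I × Iⁱ`
into `ℂⁿ⁺¹ ∖ {0}` which is `e_last` on the whole boundary of the cylinder; contract it rel that
boundary (`π_{i+1}(ℂⁿ⁺¹ ∖ 0) = 0`), transport `H` along the contraction into the stabiliser of
`e_last` without changing it on the boundary, and take upper-left blocks.
[cite: Bott1959, §1 (stable range)] [cite: HatcherAT2002, Thm. 4.41 with Prop. 4.48, Example 4.55] -/
theorem injective_homotopyGroupMap_appendOne (hi : i + 2 < 2 * (n + 1)) (B : GLd n) :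
    Function.Injective (homotopyGroupMap (N := Fin i) (appendOneGL (n := n)) B) := by
  intro a b hab
  induction a using Quotient.inductionOn with
  | h k =>
    induction b using Quotient.inductionOn with
    | h k' =>
      rw [homotopyGroupMap_mk, homotopyGroupMap_mk] at hab
      obtain ⟨H⟩ : GenLoop.Homotopic (genLoopMap appendOneGL B k) (genLoopMap appendOneGL B k') :=
        Quotient.exact hab
      -- the projected homotopy is `e_last` on the boundary of the cylinder
      let φ : C(I × (Fin i → I), CV0 (n + 1)) := ⟨fun z => proj (H z), continuous_proj.comp H.continuous⟩
      have hφ : ∀ z ∈ GenLoopPath.cylBd (Fin i), φ z = eLast n := by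
        rintro ⟨s, y⟩ hz
        change proj (H (s, y)) = eLast n
        rcases hz with h0 | h1 | hy
        · change s = 0 at h0
          subst h0
          rw [H.apply_zero]
          exact proj_appendOneGL _
        · change s = 1 at h1
          subst h1
          rw [H.apply_one]
          exact proj_appendOneGL _
        · rw [H.eq_fst s hy]
          exact proj_appendOneGL _
      have hS : Subsingleton (HomotopyGroup (Fin (i + 1)) (CV0 (n + 1)) (eLast n)) :=
        subsingleton_homotopyGroup_CV0 (by omega) _
      obtain ⟨K⟩ := nonempty_homotopyRel_cylBd_of_subsingleton hS φ hφ
      -- transport `H` along the contraction `K`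
      obtain ⟨Φ, -, hΦr, hΦs⟩ := exists_transport (Y := I × (Fin i → I)) K.toContinuousMap
      change ∀ s z, act (Φ (s, z)) (K (0, z)) = K (s, z) at hΦr
      change ∀ z, (∀ s, K (s, z) = K (0, z)) → ∀ s, Φ (s, z) = 1 at hΦs
      let L : C(I × (Fin i → I), GLd (n + 1)) :=
        ⟨fun z => Φ (1, z) * H z, (Φ.continuous.comp (continuous_const.prodMk continuous_id)).mul H.continuous⟩
      have hL : ∀ z, proj (L z) = eLast n := fun z => by
        change proj (Φ (1, z) * H z) = eLast n
        rw [proj_mul, show proj (H z) = K (0, z) by rw [K.apply_zero]; rfl, hΦr, K.apply_one]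
        rfl
      have hLbd : ∀ z ∈ GenLoopPath.cylBd (Fin i), L z = H z := fun z hz => by
        change Φ (1, z) * H z = H z
        rw [hΦs z (fun s => by rw [K.eq_fst s hz, K.apply_zero]), one_mul]
      -- upper-left blocks
      let k₂ : C(I × (Fin i → I), GLd n) :=
        ⟨fun z => ⟨upperLeft (L z).1, isUnit_det_upperLeft (hL z)⟩,
          ((continuous_upperLeft.comp (continuous_subtype_val.comp L.continuous))).subtype_mk _⟩
      have hk₂ : ∀ z ∈ GenLoopPath.cylBd (Fin i), (k₂ z).1 = upperLeft (H z).1 := fun z hz => by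
        change upperLeft (L z).1 = upperLeft (H z).1
        rw [hLbd z hz]
      apply Quotient.sound
      refine ⟨{ toFun := fun p => k₂ p
                continuous_toFun := k₂.continuous
                map_zero_left := fun y => ?_
                map_one_left := fun y => ?_
                prop' := fun s y hy => ?_ }⟩
      · apply Subtype.ext
        rw [hk₂ _ (Or.inl rfl), H.apply_zero]
        change upperLeft (appendOneGL (k y)).1 = (k y).1
        rw [coe_appendOneGL, upperLeft_appendOne]
      · apply Subtype.ext
        rw [hk₂ _ (Or.inr (Or.inl rfl)), H.apply_one]
        change upperLeft (appendOneGL (k' y)).1 = (k' y).1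
        rw [coe_appendOneGL, upperLeft_appendOne]
      · apply Subtype.ext
        change (k₂ (s, y)).1 = (k y).1
        rw [hk₂ _ (Or.inr (Or.inr hy)), H.eq_fst s hy]
        change upperLeft (appendOneGL (k y)).1 = (k y).1
        rw [coe_appendOneGL, upperLeft_appendOne]

/-- **Vanishing form, one step**: for `i < 2n`, `πᵢ(GL_{n+1}(ℂ), 1) = 0 ⇒ πᵢ(GL_n(ℂ), 1) = 0`.
[cite: Bott1959, §1 (stable range)] -/
theorem subsingleton_homotopyGroup_GLd_of_succ (hi : i < 2 * n)
    (h : Subsingleton (π_ i (GLd (n + 1)) 1)) : Subsingleton (π_ i (GLd n) 1) := by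
  haveI : Subsingleton (HomotopyGroup (Fin i) (GLd (n + 1)) (appendOneGL (1 : GLd n))) := by
    rwa [appendOneGL_one]
  exact (injective_homotopyGroupMap_appendOne (n := n) (i := i) (by omega) 1).subsingleton

/-- **Vanishing form, iterated**: for `i < 2n` and every `j`,
`πᵢ(GL_{n+j}(ℂ), 1) = 0 ⇒ πᵢ(GL_n(ℂ), 1) = 0`. [cite: Bott1959, §1 (stable range)] -/
theorem subsingleton_homotopyGroup_GLd_of_add (hi : i < 2 * n) (j : ℕ)
    (h : Subsingleton (π_ i (GLd (n + j)) 1)) : Subsingleton (π_ i (GLd n) 1) := by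
  induction j with
  | zero => exact h
  | succ j ih => exact ih (subsingleton_homotopyGroup_GLd_of_succ (n := n + j) (by omega) h)

/-- **The iterated stabilisation `ι^j : GL_n(ℂ) → GL_{n+j}(ℂ)`**, `A ↦ A ⊕ 1_j`. [folklore] -/
def appendMany (n : ℕ) : (j : ℕ) → C(GLd n, GLd (n + j))
  | 0 => ContinuousMap.id _
  | j + 1 => (appendOneGL (n := n + j)).comp (appendMany n j)

/-- `ι^0 = id`. [folklore] -/
@[simp] theorem appendMany_zero (A : GLd n) : appendMany n 0 A = A := rfl

/-- `ι^{j+1} = ι ∘ ι^j`. [folklore] -/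
theorem appendMany_succ (j : ℕ) (A : GLd n) : appendMany n (j + 1) A = appendOneGL (appendMany n j A) := rfl

/-- `ι^j 1 = 1`. [folklore] -/
@[simp] theorem appendMany_one (j : ℕ) : appendMany n j (1 : GLd n) = 1 := by
  induction j with
  | zero => rfl
  | succ j ih => rw [appendMany_succ, ih, appendOneGL_one]

/-- The matrix of `ι^j A` has `A` as its upper-left `n × n` block. [folklore] -/
theorem appendMany_apply_castLE (j : ℕ) (A : GLd n) (a b : Fin n) :
    (appendMany n j A).1 (Fin.castLE (Nat.le_add_right n j) a) (Fin.castLE (Nat.le_add_right n j) b) = A.1 a b := by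
  induction j with
  | zero => rfl
  | succ j ih =>
    rw [appendMany_succ, coe_appendOneGL]
    have ha : (Fin.castLE (Nat.le_add_right n (j + 1)) a : Fin (n + j + 1)) =
        (Fin.castLE (Nat.le_add_right n j) a).castSucc := Fin.ext rfl
    have hb : (Fin.castLE (Nat.le_add_right n (j + 1)) b : Fin (n + j + 1)) =
        (Fin.castLE (Nat.le_add_right n j) b).castSucc := Fin.ext rfl
    rw [ha, hb, appendOne_castSucc_castSucc, ih]

/-- **`(ι^j)_* : πᵢ(GL_n(ℂ), B) → πᵢ(GL_{n+j}(ℂ), ι^j B)` is injective for `i < 2n`.**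
[cite: Bott1959, §1 (stable range)] -/
theorem injective_homotopyGroupMap_appendMany (hi : i < 2 * n) (j : ℕ) (B : GLd n) :
    Function.Injective (homotopyGroupMap (N := Fin i) (appendMany n j) B) := by
  induction j with
  | zero =>
    change Function.Injective (homotopyGroupMap (N := Fin i) (ContinuousMap.id (GLd n)) B)
    rw [homotopyGroupMap_id]
    exact Function.injective_id
  | succ j ih =>
    change Function.Injective (homotopyGroupMap (N := Fin i) ((appendOneGL (n := n + j)).comp (appendMany n j)) B)
    rw [homotopyGroupMap_comp]
    exact (injective_homotopyGroupMap_appendOne (n := n + j) (by omega) _).comp ih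

/-- `g ∘ const = const`. [folklore] -/
theorem genLoopMap_const {X Y : Type*} [TopologicalSpace X] [TopologicalSpace Y] {N : Type*} (g : C(X, Y)) (x : X) :
    genLoopMap g x (GenLoop.const : Ω^ N X x) = GenLoop.const := by
  ext y; rfl

/-- **Per-class form, iterated**: for `i < 2n`, a based `i`-loop in `GL_n(ℂ)` whose `j`-fold
stabilisation `ι^j ∘ f` is null-homotopic rel `∂Iⁱ` in `GL_{n+j}(ℂ)` is null-homotopic rel `∂Iⁱ`
in `GL_n(ℂ)`. [cite: Bott1959, §1 (stable range)] -/
theorem genLoop_homotopic_const_of_appendMany (hi : i < 2 * n) (j : ℕ) (f : Ω^ (Fin i) (GLd n) 1)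
    (h : GenLoop.Homotopic (genLoopMap (appendMany n j) 1 f) GenLoop.const) :
    GenLoop.Homotopic f GenLoop.const := by
  have hinj := injective_homotopyGroupMap_appendMany (n := n) hi j 1
  have h1 : homotopyGroupMap (N := Fin i) (appendMany n j) 1 (⟦f⟧ : π_ i (GLd n) 1) =
      homotopyGroupMap (N := Fin i) (appendMany n j) 1 (⟦GenLoop.const⟧ : π_ i (GLd n) 1) := by
    rw [homotopyGroupMap_mk, homotopyGroupMap_mk, genLoopMap_const]
    exact Quotient.sound h
  exact Quotient.exact (hinj h1)

end Stability

end GLTransport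

end Literature.Topology.FourManifolds
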